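import Mathlib
import Summits.Ventures.FusionMHD.Models.SAlphaStableHalfCore0
import HarnessLib

/-!
# STABLE-POINT core at `(1, 1/2)`, piece 4 (`[15/2, 9]`): kernel-decided Taylor-model leaves ⇒ `F_4 > 0` and `amplitudeResidual 1 (1/2) F_4 F_4″ ≤ 0` on the piece ⇒ `EnergyDominatesOn` for its amplitude phase

LADDER-GRIDFUSION rung F3 («F3.BALLOON-sα-STABLE-POINT-ONE-HALF»: the next point of the stable-side scan at unit shear); gridfusion-model-7 g8, 2026-08-28.  Two `decide +kernel` calls (`OpModel.trig.pLeavesCheck`, scale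
`2^60`, Taylor degree 10, 12 leaves of half-width 1/16) and the lane's soundness theorem `OpSem.trig.pos_of_pLeavesCheck`
(Literature/Analysis/ValidatedNumerics/TaylorModelZeroCert); lit-4's `energyDominatesOn_of_amplitude` (BallooningSAlphaStableSide) turns the two
sign facts into energy domination by `amplitudePhase 1 (1/2) F_4 F_4′` on the piece.  MODELLED: `s–α` model; nothing about a device.
No `native_decide`.  Citations: Freidberg 2014 §12.6.2 (12.97) [Freidberg2014]; Makino–Berz 2003 Alg. 2 [MakinoBerz2003]; Hartman 2002 XI.6.2
[Hartman2002].  Everything here is [instance data].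
-/

open Literature.Analysis.ValidatedNumerics Literature.Analysis.ValidatedNumerics.PolyMP
open Literature.Analysis.ValidatedNumerics.NumericsMP Literature.Analysis.ValidatedNumerics.ExpPoly
open Literature.MathematicalPhysics.MHD.Ballooning
open Real Set

namespace Summit.Ventures.FusionMHD.Models

namespace SAlphaStableHalf

/-- KERNEL CHECK (residual leaves of piece 4). [instance data] -/
theorem half_res4_ok : OpModel.trig.pLeavesCheck halfPrm (2 ^ 60) (halfProg Q4 (Poly.deriv (Poly.deriv Q4))) [] halfLeaves4 = true := by
  decide +kernel

/-- KERNEL CHECK (positivity leaves of piece 4). [instance data] -/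
theorem half_pos4_ok : OpModel.trig.pLeavesCheck halfPrm (2 ^ 60) (halfPosProg Q4) [] halfLeaves4 = true := by
  decide +kernel

/-- The leaves tile `[15/2, 9]`. [instance data] -/
theorem half_tiles4 : tiles (15/2 : ℚ) (halfLeaves4.map fun l => (l.e, l.k)) (9 : ℚ) = true := by
  decide +kernel

/-- **PIECE 4**: the phase of `F_4` dominates the `s–α` energy on `[15/2, 9]` at `(s, α) = (1, 1/2)`. [instance data] -/
theorem half_dominates4 :
    SAlpha.EnergyDominatesOn 1 (1 / 2) (SAlpha.amplitudePhase 1 (1 / 2) (Poly.eval Q4) (Poly.eval (Poly.deriv Q4)))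
      (Icc (15/2 : ℝ) (9 : ℝ)) := by
  have h := half_dominates (lf := Q4) (x := 15/2) (y := 9) (by norm_num) half_tiles4 half_res4_ok half_pos4_ok
  norm_num at h
  exact h

end SAlphaStableHalf

end Summit.Ventures.FusionMHD.Models
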